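import Literature.NumberTheory.EllipticCurves.EisensteinNewformLevelRaisingOrdinaryUnitRootSpecializationProofs
import Literature.NumberTheory.GaloisRepresentations.StableLatticeValuationRing
import Literature.NumberTheory.GaloisRepresentations.GoodDihedralLocalImage
import Literature.NumberTheory.GaloisRepresentations.LocalKroneckerWeberInertiaProofs
import Literature.NumberTheory.GaloisRepresentations.DecompositionGroupOfCompletion
import Literature.NumberTheory.GaloisCohomology.Howard2004.ChebotarevInertPrimesProofs
import Literature.NumberTheory.GaloisRepresentations.FrobeniusDensity
import Literature.NumberTheory.QuadraticFields.KroneckerSplitting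
import Literature.NumberTheory.EllipticCurves.StrictSelmerRankOneDegreeOneProofs
import Literature.NumberTheory.EllipticCurves.NewformsProofs
import Literature.NumberTheory.EllipticCurves.NewformsLiftProofs
import Summits.BirchSwinnertonDyer.Rank1Residual.X11b.SplitPrimeUnramified
import Literature.NumberTheory.EllipticCurves.OrdinaryNewformDatumAttachedProofs
import Literature.NumberTheory.EllipticCurves.EisensteinNewformLevelRaisingOrdinaryProofs
import Literature.NumberTheory.EllipticCurves.PadicCoeffIntegersFrobeniusData
import Literature.FieldTheory.AlgClosed.PadicAlgClEquivComplexCompatible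
import Literature.NumberTheory.EllipticCurves.BurungaleSkinnerTianWan2024.AuxiliaryNewformSupplyPRE
import Summits.BirchSwinnertonDyer.BirchSwinnertonDyer.Theorems.ErratumRoadFiveBdvCalibrationSplitNFCalibratorDefs
import HarnessLib

set_option linter.dupNamespace false

/-!
# Calibrator gap «F-irr» — residual absolute irreducibility of the `p`-ordinary CM calibrator
(Sketch for crux `ErratumRoadFive.EulerHalfNotRamNoInertSetAtFive`, lines `kato_Fframe_r5` /
`bstw_door`; complete-lens target = conjunct `ρ.IsResiduallyAbsIrreducible` of
`…ErratumRoadFiveBdvCalibrationSplitNF.CalibratorSupplyNF`, typer memo TY-SNF gap #4).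

PART A (Hecke-character-free): an irreducible `p`-adic Galois representation
`ρ : Γ_ℚ → GL₂(ℚ̄_p)` attached to a `p`-ordinary newform of weight `2` and level prime to `p`
(`p` odd) whose traces VANISH off a proper subgroup `H ≤ Γ_ℚ` containing the image of the
inertia group at `p` is residually absolutely irreducible.  Mechanism: if some scalar extension
`τ'` of the reduction had a common eigenvector `v`, `τ' v = χ₁ v`, put `χ₂ := tr τ' - χ₁`
(again a character); `χ₁ + χ₂ = tr τ' = 0` off `H`, whence `χ₁(γ) = χ₂(γ)` for `γ ∈ H`
(translate by one `γ₀ ∉ H`); but Hida's ordinary frame at `p`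
(`Hida2000_thm326_ordinary_unitRoot.exists_residualFrame`, GRANTED printed fact) makes
`τ'|_{Γ_{ℚ_p}}` upper triangular with diagonal `(ω·unr, unr)`, `= (ω, 1)` on inertia, and local
Kronecker–Weber supplies `σ ∈ I_p` (so `γ = σ|_ℚ̄ ∈ H`) with `ω(σ) = -1`: `tr τ'(γ) = 0 = 2χ₁(γ)`,
i.e. `2 = 0`, absurd in odd residue characteristic.

PART B (docking, BSTW24 App. B currency): for the CM calibrator `g ∈ S₂(Γ₀(N))` — CM clause
`χ_K(ℓ) a_ℓ = a_ℓ (ℓ ∤ N)` by an imaginary quadratic `K` with `p` split in `K`, VERBATIM the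
`K`-conjunct of `BurungaleSkinnerTianWan2024.prop523proof_appB_exists_orientedCMNewform_PRE` —
the traces of `ρ_{g,ι'}` vanish off `Γ_K` (Čebotarev density, PROVED in the tree, + inert primes
have `a_ℓ = 0` + Deligne's `tr ρ(Frob_ℓ) = a_ℓ`) and `I_p ≤ Γ_K`; Part A applies:
`isResiduallyAbsIrreducible_of_CM`.  PART C: the same with the `K`-clause kept existential
(`isResiduallyAbsIrreducible_of_CM_clause`), token-identical to the PRE fact's output.
PART D (rev 1.1 — the TURNKEY; `ρ` CONSTRUCTED and `hirr` DISCHARGED): for ANY `ι' : ℚ̄_p ≃ ℂ`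
with `‖ι'⁻¹(a_p(g))‖ = 1` the representation `ρ := Δ.ρ ⊗ ℚ̄_p` of the integral ordinary datum
`Δ : OrdinaryNewformDatum g p (ι'⁻¹|_{K_g})` (which EXISTS by the tree theorem
`nonempty_ordinaryNewformDatum_of_thm61_of_thm326` from Deligne's theorem
`DeligneSerre1974.thm61_exists_adicGaloisRep` and `Hida2000_thm326_ordinary`, the latter implied by
`hW` via `Hida2000_thm326_ordinary_of_unitRoot`) is attached to `(g₁, ι'⁻¹|_{K₁})` away from `Np`
(`OrdinaryNewformDatum.isGaloisRepOfNewform1_baseChange_padicAlgCl`) and IRREDUCIBLE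
(`OrdinaryNewformDatum.isIrreducible_baseChange_padicAlgCl` ⇐ Ribet 1977 Thm. (2.3), PROVED in the
tree as `Ribet1977.thm23_isIrreducible_holds`): `exists_attached_isIrreducible` (any weight `k ≥ 2`).
Hence `exists_calibratorRep_of_CM_clause` / `exists_compat_calibratorRep_of_CM_clause`: from
`hW`, `h61` and the PRE fact's output ALONE, `∃ ι' ρ` satisfying conjuncts #3 (attached), #4 (F-irr)
and #5 (ordinary) of `CalibratorSupplyNF` verbatim — no `hirr` hypothesis left.
PART E (rev 1.2 — the SUPPLY TURNKEY): `calibratorSupplyNF_of_printedFacts hW h61 hPRE` IS the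
statement of `bstw_door.stub_calibratorSupplyNF` (item 33169, S2a-NF) token for token —
`∀ p ≥ 5 prime, ∀ L` imaginary quadratic, Heegner at `p`, `d_L < −4` odd, `CalibratorSupplyNF L p`
(all EIGHT conjuncts) — from the three named printed facts `hW`, `h61`,
`hPRE = BurungaleSkinnerTianWan2024.prop523proof_appB_exists_orientedCMNewform_PRE` (typer fact
p801618, BSTW24 proof of Prop. 5.23 + App. B); the gate audit classes it `proof.conditional` of the
`@[conjecture]` `CalibratorSupplyNF` modulo exactly these three.
Remaining hypotheses: `hW` = GRANTED `Hida2000_thm326_ordinary_unitRoot` (the cell's standard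
printed fact, Hida *MFG* Thm. 3.26 (2)), `h61` = `DeligneSerre1974.thm61_exists_adicGaloisRep`
(Deligne's theorem, Deligne–Serre Thm. 6.1 — a named Literature fact) and, for PART E only, `hPRE`.
`lean check`: rc 0, 0 errors, 0 sorries, axioms {propext, Classical.choice, Quot.sound} for
`calibratorSupplyNF_of_printedFacts`.
No summit statement is proved here; `CalibratorSupplyNF` is proved ONLY conditionally on the three
named facts; BSD is proved for no curve by this file.
-/

namespace Summit.BirchSwinnertonDyer.BirchSwinnertonDyer.Cruxes.EulerHalfNotRamNoInertSetAtFive.CalibratorFirr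

open scoped MatrixGroups NumberField Matrix
open Literature.NumberTheory.GaloisRepresentations
open Literature.NumberTheory.EllipticCurves
open Literature.NumberTheory.EllipticCurves.ModularForms
open IsDedekindDomain Field

/-! ## A.1  Pure algebra: traces vanishing off a subgroup vs. a trace-zero element inside it -/

section Core

variable {G : Type*} [Group G] {k : Type*} [Field k]

/-- **Core lemma (frame-free).** Let `τ : G → GL₂(k)` have a common eigenvector, let `H ≤ G`
be a proper subgroup with `tr τ(γ) = 0` for every `γ ∉ H`, and let `γ ∈ H` have `tr τ(γ) = 0`.
Then `2 = 0` in `k`.  (With `χ₁` the eigenvalue character on the common eigenvector and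
`χ₂ := tr τ - χ₁` the other diagonal character: `χ₂(γ₀) = -χ₁(γ₀)` and
`χ₁(γ₀)χ₁(γ) + χ₂(γ₀)χ₂(γ) = 0` give `χ₁(γ) = χ₂(γ)`, so `0 = tr τ(γ) = 2χ₁(γ)`.) [folklore] -/
theorem two_eq_zero_of_trace_eq_zero_off_subgroup (τ : G →* GL (Fin 2) k) (H : Subgroup G)
    {γ₀ : G} (hγ₀ : γ₀ ∉ H)
    (htr : ∀ g, g ∉ H → Matrix.trace ((τ g : GL (Fin 2) k) : Matrix (Fin 2) (Fin 2) k) = 0)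
    (hce : HasCommonEigenvector τ) {γ : G} (hγ : γ ∈ H)
    (hγtr : Matrix.trace ((τ γ : GL (Fin 2) k) : Matrix (Fin 2) (Fin 2) k) = 0) :
    (2 : k) = 0 := by
  classical
  obtain ⟨v, hv, key⟩ := hce
  choose a ha using key
  -- notation
  set M : G → Matrix (Fin 2) (Fin 2) k := fun g => ((τ g : GL (Fin 2) k) : Matrix (Fin 2) (Fin 2) k)
    with hMdef
  have haM : ∀ g, M g *ᵥ v = a g • v := fun g => ha g
  -- the eigenvalue character is non-zero and multiplicative
  have ha0 : ∀ g, a g ≠ 0 := by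
    intro g hg
    apply hv
    have h1 : M g *ᵥ v = 0 := by rw [haM g, hg, zero_smul]
    have h2 : (((τ g)⁻¹ : GL (Fin 2) k) : Matrix (Fin 2) (Fin 2) k) *ᵥ (M g *ᵥ v) = v := by
      rw [Matrix.mulVec_mulVec, hMdef]
      dsimp only
      rw [← Matrix.GeneralLinearGroup.coe_mul, inv_mul_cancel, Matrix.GeneralLinearGroup.coe_one,
        Matrix.one_mulVec]
    rw [← h2, h1, Matrix.mulVec_zero]
  have hamul : ∀ g h, a (g * h) = a g * a h := by
    intro g h
    have e : a (g * h) • v = (a g * a h) • v := by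
      rw [← haM, hMdef]
      dsimp only
      rw [map_mul, Matrix.GeneralLinearGroup.coe_mul, ← Matrix.mulVec_mulVec]
      change M g *ᵥ (M h *ᵥ v) = _
      rw [haM h, Matrix.mulVec_smul, haM g, smul_smul, mul_comm]
    exact smul_left_injective k hv e
  -- the eigenvalue is a root of the characteristic polynomial: `a² - tr·a + det = 0`
  have hchar : ∀ g, a g ^ 2 - (M g).trace * a g + (M g).det = 0 := by
    intro g
    have e0 := congr_fun (haM g) 0
    have e1 := congr_fun (haM g) 1
    simp only [Matrix.mulVec, dotProduct, Fin.sum_univ_two, Pi.smul_apply, smul_eq_mul] at e0 e1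
    rw [Matrix.trace_fin_two, Matrix.det_fin_two]
    have hx : v 0 * (a g ^ 2 - ((M g) 0 0 + (M g) 1 1) * a g +
        ((M g) 0 0 * (M g) 1 1 - (M g) 0 1 * (M g) 1 0)) = 0 := by
      linear_combination ((M g) 1 1 - a g) * e0 - (M g) 0 1 * e1
    have hy : v 1 * (a g ^ 2 - ((M g) 0 0 + (M g) 1 1) * a g +
        ((M g) 0 0 * (M g) 1 1 - (M g) 0 1 * (M g) 1 0)) = 0 := by
      linear_combination ((M g) 0 0 - a g) * e1 - (M g) 1 0 * e0
    by_contra hne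
    apply hv
    ext i
    fin_cases i
    · exact (mul_eq_zero.mp hx).resolve_right hne
    · exact (mul_eq_zero.mp hy).resolve_right hne
  -- the complementary character `b := tr - a`, with `a * b = det`, is multiplicative
  set b : G → k := fun g => (M g).trace - a g with hbdef
  have hab : ∀ g, a g * b g = (M g).det := by
    intro g
    have := hchar g
    simp only [hbdef]
    linear_combination -this
  have hdetmul : ∀ g h, (M (g * h)).det = (M g).det * (M h).det := by
    intro g h
    simp only [hMdef, map_mul, Matrix.GeneralLinearGroup.coe_mul, Matrix.det_mul]
  have hbmul : ∀ g h, b (g * h) = b g * b h := by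
    intro g h
    have h1 : a (g * h) * b (g * h) = (a g * b g) * (a h * b h) := by
      rw [hab, hab, hab, hdetmul]
    rw [hamul] at h1
    have h2 : a g * a h * (b (g * h) - b g * b h) = 0 := by linear_combination h1
    rcases mul_eq_zero.mp h2 with h3 | h3
    · rcases mul_eq_zero.mp h3 with h4 | h4
      · exact absurd h4 (ha0 g)
      · exact absurd h4 (ha0 h)
    · exact sub_eq_zero.mp h3
  have htrab : ∀ g, (M g).trace = a g + b g := fun g => by simp only [hbdef]; ring
  -- `a = b` at `γ ∈ H`
  have h1 : a γ₀ + b γ₀ = 0 := by rw [← htrab]; exact htr γ₀ hγ₀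
  have h2 : a (γ₀ * γ) + b (γ₀ * γ) = 0 := by
    rw [← htrab]
    exact htr _ fun hmem => hγ₀ (by simpa using H.mul_mem hmem (H.inv_mem hγ))
  rw [hamul, hbmul] at h2
  have h3 : a γ₀ * (a γ - b γ) = 0 := by linear_combination h2 - b γ * h1
  have h4 : a γ = b γ := by
    rcases mul_eq_zero.mp h3 with h | h
    · exact absurd h (ha0 γ₀)
    · exact sub_eq_zero.mp h
  -- `0 = tr τ(γ) = 2 a(γ)`
  have h5 : (2 : k) * a γ = 0 := by
    have := htrab γ
    rw [hγtr, ← h4, ← two_mul] at this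
    exact this.symm
  rcases mul_eq_zero.mp h5 with h | h
  · exact h
  · exact absurd h (ha0 γ)

/-- Trace is a conjugation invariant in `GL₂(k)` (the form used with residual frames). [folklore] -/
theorem trace_conj_eq (Q A : GL (Fin 2) k) :
    Matrix.trace ((Q⁻¹ * A * Q : GL (Fin 2) k) : Matrix (Fin 2) (Fin 2) k) =
      Matrix.trace ((A : GL (Fin 2) k) : Matrix (Fin 2) (Fin 2) k) := by
  rw [Matrix.GeneralLinearGroup.coe_mul, Matrix.GeneralLinearGroup.coe_mul, Matrix.trace_mul_cycle,
    ← Matrix.GeneralLinearGroup.coe_mul, mul_inv_cancel, Matrix.GeneralLinearGroup.coe_one,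
    Matrix.one_mul]

end Core

/-! ## A.2  Odd residue characteristic -/

/-- `p` reduces to `0` in the residue field of the valuation ring `ℤ̄_p` of `ℚ̄_p`
(`v(p) = 1/p < 1`, so `p` is a non-unit of `ℤ̄_p`). [folklore] -/
theorem residue_natCast_eq_zero (p : ℕ) [Fact p.Prime] :
    IsLocalRing.residue (padicAlgClIntegers p) (p : padicAlgClIntegers p) = 0 := by
  have hp : (p : ℕ).Prime := Fact.out
  rw [IsLocalRing.residue_eq_zero_iff, IsLocalRing.mem_maximalIdeal, mem_nonunits_iff]
  intro hu
  have hlt : Valued.v ((p : padicAlgClIntegers p) : PadicAlgCl p) < 1 := by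
    rw [show ((p : padicAlgClIntegers p) : PadicAlgCl p) = (p : PadicAlgCl p) from rfl,
      PadicAlgCl.valuation_p]
    have hp1 : (1 : NNReal) < p := by exact_mod_cast hp.one_lt
    rw [one_div]
    exact inv_lt_one_of_one_lt₀ hp1
  -- a unit of `ℤ̄_p` has valuation `1`
  obtain ⟨u, hu'⟩ := hu
  have h1 : Valued.v ((u : padicAlgClIntegers p) : PadicAlgCl p) *
      Valued.v (((u⁻¹ : (padicAlgClIntegers p)ˣ) : padicAlgClIntegers p) : PadicAlgCl p) = 1 := by
    rw [← map_mul, ← Subring.coe_mul]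
    have := congrArg (fun y : padicAlgClIntegers p => Valued.v (y : PadicAlgCl p)) u.mul_inv
    simpa only [Units.val_one, OneMemClass.coe_one, map_one] using this
  have h2 : Valued.v (((u⁻¹ : (padicAlgClIntegers p)ˣ) : padicAlgClIntegers p) : PadicAlgCl p) ≤ 1 :=
    (Valuation.mem_valuationSubring_iff _ _).mp (SetLike.coe_mem _)
  rw [hu'] at h1
  have h3 : Valued.v ((p : padicAlgClIntegers p) : PadicAlgCl p) *
      Valued.v (((u⁻¹ : (padicAlgClIntegers p)ˣ) : padicAlgClIntegers p) : PadicAlgCl p) < 1 * 1 :=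
    mul_lt_mul_of_lt_of_le_of_nonneg_of_pos hlt h2 zero_le zero_lt_one
  rw [h1, one_mul] at h3
  exact lt_irrefl _ h3

/-- In a field receiving the residue field of `ℤ̄_p` with `p` odd, `2 ≠ 0`. [folklore] -/
theorem two_ne_zero_of_residueField {p : ℕ} [Fact p.Prime] (hp2 : p ≠ 2) {k' : Type*} [Field k']
    (f : padicAlgClResidueField p →+* k') : (2 : k') ≠ 0 := by
  have hp : (p : ℕ).Prime := Fact.out
  have hpk : (p : k') = 0 := by
    have h := congrArg f (residue_natCast_eq_zero p)
    rwa [map_natCast, map_zero, map_natCast] at h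
  intro h2
  have hchar2 : ringChar k' ∣ 2 := (ringChar.spec k' 2).mp (by exact_mod_cast h2)
  have hcharp : ringChar k' ∣ p := (ringChar.spec k' p).mp (by exact_mod_cast hpk)
  have hne1 : ringChar k' ≠ 1 := by
    intro h1
    have h : ringChar k' ∣ 1 := by rw [h1]
    have h' : ((1 : ℕ) : k') = 0 := (ringChar.spec k' 1).mpr h
    exact one_ne_zero (by exact_mod_cast h')
  have h2' : ringChar k' = 2 := by
    rcases (Nat.dvd_prime Nat.prime_two).mp hchar2 with h | h
    · exact absurd h hne1
    · exact h
  rw [h2'] at hcharp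
  exact hp2 ((Nat.prime_dvd_prime_iff_eq Nat.prime_two hp).mp hcharp).symm

/-! ## A.3  Theorem A: residual absolute irreducibility from trace-zero-off-`H` + Hida frame -/

/-- **Theorem A (Galois level, Hecke-character-free).**  Let `g₁` be a newform of weight `2`
and level `N` with `p ∤ N`, `p` odd, `p`-ordinary for `ι : ℚ̄_p ≃ ℂ` (`v(ι⁻¹ a_p) = 1`), and
`ρ : Γ_ℚ → GL₂(ℚ̄_p)` an irreducible representation attached to `g₁`, unramified outside `Np`.
If the traces of `ρ` vanish off a proper subgroup `H ≤ Γ_ℚ` containing the image of the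
inertia group of `Γ_{ℚ_w}`, `w` the place above `p`, then some (hence every) reduction of `ρ`
is absolutely irreducible (`IsResiduallyAbsIrreducible`).  GRANTED: Hida's ordinary unit-root
frame `Hida2000_thm326_ordinary_unitRoot` (printed: H. Hida, *Modular Forms and Galois
Cohomology*, CUP 2000, Thm. 3.26 (2), p. 152); the inertia surjectivity of the cyclotomic
character is the tree theorem `adicCompletion_rat_exists_mem_absInertia_cyclotomicCharacter_eq`
(local Kronecker–Weber). [cite: Hida2000, Thm. 3.26 (2), p. 152] -/
theorem isResiduallyAbsIrreducible_of_trace_eq_zero_off_subgroup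
    (hW : Hida2000_thm326_ordinary_unitRoot) {N : ℕ} [NeZero N]
    (g₁ : CuspForm (CongruenceSubgroup.Gamma1 N) 2) (hg₁ : IsNewform1 g₁)
    (p : ℕ) [Fact p.Prime] (hp2 : p ≠ 2) (ι : PadicAlgCl p ≃+* ℂ) (hpN : ¬ p ∣ N)
    (hap : Valued.v (ι.symm ((UpperHalfPlane.qExpansion 1 ⇑g₁).coeff p)) = 1)
    (ρ : FramedGaloisRep ℚ (PadicAlgCl p) 2)
    (hρ : IsGaloisRepOfNewform1 g₁ ((ι.symm : ℂ →+* PadicAlgCl p).comp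
      (algebraMap (coeffCharField g₁) ℂ)) {q | q ∣ N * p} ρ)
    (hirr : ρ.toGaloisRep.IsIrreducible)
    (H : Subgroup (absoluteGaloisGroup ℚ)) (hH : ∃ γ₀, γ₀ ∉ H)
    (htr : ∀ γ, γ ∉ H →
      Matrix.trace ((ρ γ : GL (Fin 2) (PadicAlgCl p)) : Matrix (Fin 2) (Fin 2) (PadicAlgCl p)) = 0)
    (w : HeightOneSpectrum (𝓞 ℚ)) (hw : (p : 𝓞 ℚ) ∈ w.asIdeal)
    (hI : ∀ σ ∈ absInertia (w.adicCompletion ℚ), absGaloisRestrict ℚ (w.adicCompletion ℚ) σ ∈ H) :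
    ρ.IsResiduallyAbsIrreducible := by
  classical
  have hp : (p : ℕ).Prime := Fact.out
  obtain ⟨γ₀, hγ₀⟩ := hH
  -- an integral model and its reduction
  obtain ⟨P, ρ₀, hP⟩ := exists_integralModel_of_valuationSubring (O := padicAlgClIntegers p)
    (Valued.isOpen_valuationSubring _) ρ
  set τ₀ := integralReduction (RingHom.id (padicAlgClResidueField p)) ρ₀ with hτ₀def
  have hτ₀ : ρ.IsReductionOf (RingHom.id _) τ₀ :=
    ⟨ρ₀, 1, ⟨P, hP⟩, fun g => by rw [one_mul, inv_one, mul_one]⟩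
  refine ⟨τ₀, hτ₀, ?_⟩
  intro k' _ f
  -- the scalar extension `τ' = GL₂(f) ∘ τ₀` is again a reduction of `ρ`
  set τ' : absoluteGaloisGroup ℚ →* GL (Fin 2) k' := (Matrix.GeneralLinearGroup.map f).comp τ₀
    with hτ'def
  have hτ' : ρ.IsReductionOf f τ' := by
    refine ⟨ρ₀, 1, ⟨P, hP⟩, fun g => ?_⟩
    rw [one_mul, inv_one, mul_one, hτ'def, hτ₀def]
    ext i j
    rfl
  -- either no common eigenvector (done) or derive `2 = 0`
  by_contra hnot
  have hce : HasCommonEigenvector τ' := by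
    by_contra hce
    exact hnot (isIrreducible_of_not_hasCommonEigenvector τ' hce)
  -- traces of `τ'` vanish off `H` (they are reductions of the traces of `ρ`)
  have htr' : ∀ γ, γ ∉ H → Matrix.trace ((τ' γ : GL (Fin 2) k') : Matrix (Fin 2) (Fin 2) k') = 0 := by
    intro γ hγ
    obtain ⟨Pγ, hPF, hPk⟩ := hτ'.hasResidualCharpolys γ
    have hPF' : Pγ.map (padicAlgClIntegers p).subtype =
        ((ρ γ : GL (Fin 2) (PadicAlgCl p)) : Matrix (Fin 2) (Fin 2) (PadicAlgCl p)).charpoly := hPF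
    clear hPF
    have hPF := hPF'
    have hF := Matrix.trace_eq_neg_charpoly_coeff
      ((ρ γ : GL (Fin 2) (PadicAlgCl p)) : Matrix (Fin 2) (Fin 2) (PadicAlgCl p))
    have hk := Matrix.trace_eq_neg_charpoly_coeff ((τ' γ : GL (Fin 2) k') : Matrix (Fin 2) (Fin 2) k')
    rw [Fintype.card_fin] at hF hk
    norm_num at hF hk
    rw [htr γ hγ, ← hPF, Polynomial.coeff_map] at hF
    have h0 : Pγ.coeff 1 = 0 := by
      have : ((padicAlgClIntegers p).subtype (Pγ.coeff 1) : PadicAlgCl p) = 0 := by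
        rw [eq_comm, neg_eq_zero] at hF
        exact hF
      exact Subtype.ext this
    rw [hk, ← hPk, Polynomial.coeff_map, h0, map_zero, neg_zero]
  -- Hida's ordinary frame for the reduction `τ'`
  obtain ⟨Q, α, Qbar, a, δ, -, -, hfr⟩ :=
    hW.exists_residualFrame g₁ (by norm_num) hg₁ p ι hpN hap ρ hρ hirr w hw hτ'
  -- an inertia element with `ω(σ) = -1`
  have hv : ((Rat.HeightOneSpectrum.primesEquiv w : Nat.Primes) : ℕ) = p := by
    have h1 : Rat.HeightOneSpectrum.natGenerator w ∣ p := (Rat.natCast_mem_asIdeal_iff w).mp hw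
    exact (Nat.prime_dvd_prime_iff_eq (Rat.HeightOneSpectrum.primesEquiv w).2 hp).mp h1
  obtain ⟨σ, hσI, hσχ⟩ :=
    adicCompletion_rat_exists_mem_absInertia_cyclotomicCharacter_eq p w hv (-1)
  obtain ⟨-, ⟨-, h00, h11⟩, hinσ, -⟩ := hfr σ
  obtain ⟨hδ, ha⟩ := hinσ hσI
  -- `a σ = -1`, `δ σ = 1`, so the framed `τ'(σ)` has diagonal `(-1, 1)` and trace `0`
  have ha' : a σ = -1 := by
    apply Subtype.ext
    rw [ha, hσχ, show ((2 : ℤ) - 1) = 1 by norm_num, zpow_one, Units.val_neg, Units.val_one,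
      PadicInt.coe_neg, PadicInt.coe_one, map_neg, map_one]
    rfl
  rw [ha', map_neg, map_one, map_neg, map_one] at h00
  rw [hδ, map_one, map_one] at h11
  have hγtr : Matrix.trace ((τ' (absGaloisRestrict ℚ (w.adicCompletion ℚ) σ) : GL (Fin 2) k') :
      Matrix (Fin 2) (Fin 2) k') = 0 := by
    rw [← trace_conj_eq Qbar, Matrix.trace_fin_two]
    change (Qbar⁻¹ * τ' (absGaloisRestrict ℚ (w.adicCompletion ℚ) σ) * Qbar).val 0 0 +
      (Qbar⁻¹ * τ' (absGaloisRestrict ℚ (w.adicCompletion ℚ) σ) * Qbar).val 1 1 = 0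
    rw [h00, h11]; ring
  exact two_ne_zero_of_residueField hp2 f
    (two_eq_zero_of_trace_eq_zero_off_subgroup τ' H hγ₀ htr' hce (hI σ hσI) hγtr)

/-! ## B  Docking: the CM calibrator of `CalibratorSupplyNF` (BSTW24 App. B currency)

For a weight-two newform `g ∈ S₂(Γ₀(N))` with CM by an imaginary quadratic field `K`
(`χ_K(ℓ) a_ℓ = a_ℓ` for primes `ℓ ∤ N` — verbatim the CM clause of
`BurungaleSkinnerTianWan2024.prop523proof_appB_exists_orientedCMNewform_PRE`) in which `p`
splits (`SatisfiesHeegnerHypothesis p K`, loc. cit.), the traces of `ρ = ρ_{g,ι'}` vanish off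
`Γ_K ≤ Γ_ℚ`: by Čebotarev (`absoluteGaloisGroup.frobenius_dense`, PROVED in the tree from
`chebotarevArtinRep_holds`) the good Frobenii are dense; a Frobenius `Frob_ℓ ∉ Γ_K` sits at an
inert `ℓ` (`exists_place_inert_of_not_mem_range`), so `(d_K/ℓ) ≠ 1`, `χ_K(ℓ) ≠ 1`, `a_ℓ = 0`
and `tr ρ(Frob_ℓ) = ι'(a_ℓ) = 0` (Deligne, `IsGaloisRepOfNewform1`); `Γ_K ∪ {tr ρ = 0}` is closed.
And `I_p ≤ Γ_K` because `p` is unramified in `K`.  Part A then gives residual absolute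
irreducibility.  Remaining hypotheses = typer debts, see `Lines/calibrator_Firr_print.md`:
`hW` (GRANTED Hida 2000 Thm 3.26(2), the cell's standard printed fact), `hirr` (char-0
irreducibility of `ρ_{g,ι'}`: Ribet 1977 Thm 2.3, typed in the tree only for finite `E/ℚ_ℓ`). -/

section Docking

open Rat.HeightOneSpectrum (primesEquiv natGenerator)

/-- Coefficient `1` of the Hecke polynomial `X² − a_q X + ε(q) q^{k-1}` is `−a_q`. [folklore] -/
theorem heckePolynomial_coeff_one {N : ℕ} [NeZero N] {k : ℤ}
    (f : CuspForm (CongruenceSubgroup.Gamma1 N) k) (q : ℕ) :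
    (heckePolynomial f q).coeff 1 =
      -⟨(UpperHalfPlane.qExpansion 1 ⇑f).coeff q, cuspCoeff_mem_coeffCharField f q⟩ := by
  simp [heckePolynomial, Polynomial.coeff_C, Polynomial.coeff_X_pow]

/-- **Theorem B (F-irr for the CM calibrator).**  Let `g ∈ S₂(Γ₀(N))` be a newform, `p ∤ 2N`,
`ι' : ℚ̄_p ≃ ℂ`, `ρ : Γ_ℚ → GL₂(ℚ̄_p)` attached to `g` away from `N p` (Deligne) and irreducible,
`a_p(g)` a `p`-adic unit (ordinarity), and suppose `g` has CM by an imaginary quadratic `K` in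
which `p` splits — hypotheses `hK`, `hpK`, `χK`, `hχK`, `hCM` are VERBATIM the `K`-clause of
`prop523proof_appB_exists_orientedCMNewform_PRE` (BSTW24 App. B).  Then `ρ̄ ⊗ \bar k` is
irreducible for every extension `k'` of the residue field, i.e. `ρ.IsResiduallyAbsIrreducible` —
the conjunct «F-irr» of `CalibratorSupplyNF` (typer memo TY-SNF gap #4), modulo the GRANTED
printed fact `hW` and the char-0 irreducibility `hirr`.
[cite: Hida2000, Thm. 3.26 (2), p. 152] [cite: Ribet1977, Thm. (2.3)]
[cite: BurungaleSkinnerTianWan2024, Prop. 5.23 and App. B] -/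
theorem isResiduallyAbsIrreducible_of_CM (hW : Hida2000_thm326_ordinary_unitRoot)
    {N : ℕ} [NeZero N] (g : CuspForm (CongruenceSubgroup.Gamma0 N) 2) (hg : IsNewform0 g)
    (p : ℕ) [Fact p.Prime] (hp2 : p ≠ 2) (hpN : ¬ p ∣ N) (ι' : PadicAlgCl p ≃+* ℂ)
    (hap : ‖ι'.symm (cuspCoeff g p)‖ = 1)
    (ρ : FramedGaloisRep ℚ (PadicAlgCl p) 2)
    (hρ : IsGaloisRepOfNewform1 (liftToGamma1 N 2 g)
      (ι'.symm.toRingHom.comp (algebraMap (coeffCharField (liftToGamma1 N 2 g)) ℂ))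
      {ℓ : ℕ | ℓ ∣ N * p} ρ)
    (hirr : ρ.toGaloisRep.IsIrreducible)
    {K : Type} [Field K] [NumberField K] (hK : IsImaginaryQuadratic K)
    (hpK : SatisfiesHeegnerHypothesis p K)
    (χK : DirichletCharacter ℂ (NumberField.discr K).natAbs)
    (hχK : ∀ n : ℕ, Odd n → χK n = (jacobiSym (NumberField.discr K) n : ℂ))
    (hCM : ∀ ℓ : ℕ, ℓ.Prime → ¬ ℓ ∣ N → χK ℓ * cuspCoeff g ℓ = cuspCoeff g ℓ) :
    ρ.IsResiduallyAbsIrreducible := by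
  classical
  have hp : p.Prime := Fact.out
  haveI : Algebra.IsQuadraticExtension ℚ K := ⟨hK.1⟩
  -- `Γ₀(N) → Γ₁(N)`
  have hg₁ : IsNewform1 (liftToGamma1 N 2 g) := (isNewform1_liftToGamma1_iff_holds N 2 g).mpr hg
  have hcoe : (⇑(liftToGamma1 N 2 g) : UpperHalfPlane → ℂ) = ⇑g :=
    coe_liftToGamma1_holds (N := N) (k := 2) g
  have hcoeff : ∀ n : ℕ, (UpperHalfPlane.qExpansion 1 ⇑(liftToGamma1 N 2 g)).coeff n = cuspCoeff g n := by
    intro n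
    rw [hcoe]
    rfl
  have hap' : Valued.v (ι'.symm ((UpperHalfPlane.qExpansion 1 ⇑(liftToGamma1 N 2 g)).coeff p)) = 1 := by
    rw [hcoeff, PadicAlgCl.valuation_def, ← NNReal.coe_inj, coe_nnnorm, NNReal.coe_one]
    exact hap
  -- the place `w = (p)` of `ℚ`
  set w : HeightOneSpectrum (𝓞 ℚ) := primesEquiv.symm ⟨p, hp⟩ with hwdef
  have hwp : ((primesEquiv w : Nat.Primes) : ℕ) = p := by
    rw [hwdef, Equiv.apply_symm_apply]
  have hw : (p : 𝓞 ℚ) ∈ w.asIdeal :=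
    (Rat.natCast_mem_asIdeal_iff w).mpr
      (by rw [show natGenerator w = ((primesEquiv w : Nat.Primes) : ℕ) from rfl, hwp])
  -- `H = Γ_K ≤ Γ_ℚ`, of index two
  set H : Subgroup (absoluteGaloisGroup ℚ) := (absGaloisRestrict ℚ K).range with hHdef
  have hHi : H.index = 2 := (index_range_absGaloisRestrict_eq_finrank ℚ K).trans hK.1
  haveI hHn : H.Normal := Subgroup.normal_of_index_eq_two hHi
  have hH : ∃ γ₀, γ₀ ∉ H := by
    by_contra hall
    push Not at hall
    have h1 : H.index = 1 := Subgroup.index_eq_one.mpr ((Subgroup.eq_top_iff' H).mpr hall)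
    omega
  -- inertia at `p` lies in `H` (`p` splits in `K`, so is unramified)
  have hunrp : Algebra.IsUnramifiedIn (𝓞 K) w.asIdeal :=
    Summit.BirchSwinnertonDyer.Rank1Residual.X11b.isUnramifiedIn_of_satisfiesHeegnerHypothesis_of_dvd
      hK hpK hp (dvd_refl p) w hw
  have hI : ∀ σ ∈ absInertia (w.adicCompletion ℚ),
      absGaloisRestrict ℚ (w.adicCompletion ℚ) σ ∈ H := by
    intro σ hσ
    have hle := inertia_le_range_absGaloisRestrict_of_isUnramifiedIn (K := K) hunrp
      (adicCompletionPrime_mem_primesAbove ℚ w)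
    exact hle (by
      rw [inertia_adicCompletionPrime_eq_map_absInertia]
      exact Subgroup.mem_map_of_mem _ hσ)
  -- traces vanish off `H`
  have htr : ∀ γ, γ ∉ H →
      Matrix.trace ((ρ γ : GL (Fin 2) (PadicAlgCl p)) : Matrix (Fin 2) (Fin 2) (PadicAlgCl p)) = 0 := by
    -- the finite exceptional set of places and the dense set of good Frobenii
    set S : Set (HeightOneSpectrum (𝓞 ℚ)) :=
      {v | ((primesEquiv v : Nat.Primes) : ℕ) ∣ 2 * N * p} ∪
        {v | ¬ Algebra.IsUnramifiedIn (𝓞 K) v.asIdeal} with hSdef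
    have hS : S.Finite := by
      refine Set.Finite.union ?_ (finite_setOf_not_isUnramifiedIn ℚ K)
      have hfin : {n : ℕ | n ∣ 2 * N * p}.Finite :=
        (2 * N * p).divisors.finite_toSet.subset fun n hn ↦
          Nat.mem_divisors.mpr ⟨hn, mul_ne_zero (mul_ne_zero two_ne_zero (NeZero.ne N)) hp.ne_zero⟩
      refine (hfin.preimage (f := fun v : HeightOneSpectrum (𝓞 ℚ) ↦ ((primesEquiv v : Nat.Primes) : ℕ))
        fun v _ w _ h ↦ primesEquiv.injective (Subtype.ext h)).subset ?_
      intro v hv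
      exact hv
    set D : Set (absoluteGaloisGroup ℚ) :=
      {σ | ∃ v ∉ S, ∃ 𝔓 ∈ v.primesAbove, IsArithFrobAt (𝓞 ℚ) σ 𝔓} with hDdef
    have hD : Dense D :=
      absoluteGaloisGroup.frobenius_dense
        Literature.NumberTheory.Automorphic.chebotarev_artinRep_of_galoisSide ℚ S hS
    -- the closed set `H ∪ {tr ρ = 0}`
    have hcont : Continuous fun γ : absoluteGaloisGroup ℚ ↦
        Matrix.trace ((ρ γ : GL (Fin 2) (PadicAlgCl p)) : Matrix (Fin 2) (Fin 2) (PadicAlgCl p)) :=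
      (Units.continuous_val.comp (map_continuous ρ)).matrix_trace
    set C : Set (absoluteGaloisGroup ℚ) := (H : Set (absoluteGaloisGroup ℚ)) ∪
      (fun γ : absoluteGaloisGroup ℚ ↦
        Matrix.trace ((ρ γ : GL (Fin 2) (PadicAlgCl p)) : Matrix (Fin 2) (Fin 2) (PadicAlgCl p))) ⁻¹' {0}
      with hCdef
    have hHclosed : IsClosed (H : Set (absoluteGaloisGroup ℚ)) := by
      rw [hHdef, MonoidHom.coe_range]
      exact isClosed_range_absGaloisRestrict (K := ℚ) (L := K)
    have hCclosed : IsClosed C := hHclosed.union (isClosed_singleton.preimage hcont)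
    -- every good Frobenius lies in `C`
    have hDC : D ⊆ C := by
      rintro σ ⟨v, hvS, 𝔓, h𝔓, hσ⟩
      by_cases hσH : σ ∈ H
      · exact Or.inl hσH
      right
      -- the prime `ℓ` under `v`: odd, prime to `N p`, unramified in `K`
      set ℓ : ℕ := ((primesEquiv v : Nat.Primes) : ℕ) with hℓdef
      have hℓ : ℓ.Prime := (primesEquiv v).2
      have hℓv : (ℓ : 𝓞 ℚ) ∈ v.asIdeal := (Rat.natCast_mem_asIdeal_iff v).mpr dvd_rfl
      have hℓ2Np : ¬ ℓ ∣ 2 * N * p := fun h ↦ hvS (Or.inl h)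
      have hunr : Algebra.IsUnramifiedIn (𝓞 K) v.asIdeal := by
        by_contra hn
        exact hvS (Or.inr hn)
      have hℓ2 : ℓ ≠ 2 := by
        intro h2
        apply hℓ2Np
        rw [h2]
        exact dvd_mul_of_dvd_left (dvd_mul_right 2 N) p
      have hℓN : ¬ ℓ ∣ N := fun h ↦ hℓ2Np (dvd_mul_of_dvd_left (dvd_mul_of_dvd_right h 2) p)
      have hℓNp : ¬ ℓ ∣ N * p := fun h ↦ hℓ2Np (by rw [mul_assoc]; exact h.mul_left 2)
      -- `ℓ` is inert in `K` (its Frobenius `σ` is not in `Γ_K`)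
      have hI𝔓 := inertia_le_range_absGaloisRestrict_of_isUnramifiedIn (K := K) hunr h𝔓
      obtain ⟨wK, 𝔔, τ, hwv, -, hdeg, -, -, -, -⟩ :=
        exists_place_inert_of_not_mem_range (F := ℚ) (M := K) (hK.1 ▸ Nat.prime_two) hHn
          (index_range_absGaloisRestrict_eq_finrank ℚ K) hunr h𝔓 hI𝔓 hσ hσH
      rw [hK.1] at hdeg
      have hℓw : ((ℓ : ℕ) : 𝓞 K) ∈ wK.asIdeal := by
        have h1 : ((ℓ : ℕ) : 𝓞 ℚ) ∈ (wK.under (𝓞 ℚ)).asIdeal := by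
          rw [hwv]
          exact hℓv
        rw [HeightOneSpectrum.under_asIdeal, Ideal.under_def, Ideal.mem_comap, map_natCast] at h1
        exact h1
      -- so `(d_K / ℓ) ≠ 1`
      have hj : jacobiSym (NumberField.discr K) ℓ ≠ 1 := by
        intro hj
        haveI := Fact.mk hℓ
        have hsplit :=
          (Literature.NumberTheory.QuadraticFields.Quadratic.ncard_primesOver_eq_two_iff_jacobiSym
            hK.1 hℓ hℓ2).mpr hj
        have hf := (ramificationIdx_eq_one_and_inertiaDeg_eq_one_of_ncard_primesOver_eq_two
          ℓ hK.1 hsplit wK hℓw).2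
        omega
      -- hence `a_ℓ(g) = 0` (CM)
      have ha0 : cuspCoeff g ℓ = 0 := by
        have h := hCM ℓ hℓ hℓN
        rw [hχK ℓ (hℓ.odd_of_ne_two hℓ2)] at h
        have h' : ((jacobiSym (NumberField.discr K) ℓ : ℂ) - 1) * cuspCoeff g ℓ = 0 := by
          linear_combination h
        rcases mul_eq_zero.mp h' with h1 | h1
        · exact absurd (sub_eq_zero.mp h1) (by exact_mod_cast hj)
        · exact h1
      -- and `tr ρ(σ) = ι'(a_ℓ) = 0` (Deligne)
      obtain ⟨-, hchar⟩ := hρ v hℓNp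
      have hc := hchar 𝔓 h𝔓 σ hσ
      change ((ρ σ : GL (Fin 2) (PadicAlgCl p)) : Matrix (Fin 2) (Fin 2) (PadicAlgCl p)).charpoly = _
        at hc
      have htrσ := Matrix.trace_eq_neg_charpoly_coeff
        ((ρ σ : GL (Fin 2) (PadicAlgCl p)) : Matrix (Fin 2) (Fin 2) (PadicAlgCl p))
      rw [Fintype.card_fin] at htrσ
      norm_num at htrσ
      have h0 : (⟨(UpperHalfPlane.qExpansion 1 ⇑(liftToGamma1 N 2 g)).coeff ℓ,
          cuspCoeff_mem_coeffCharField (liftToGamma1 N 2 g) ℓ⟩ :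
            coeffCharField (liftToGamma1 N 2 g)) = 0 := by
        apply Subtype.ext
        change (UpperHalfPlane.qExpansion 1 ⇑(liftToGamma1 N 2 g)).coeff ℓ = 0
        rw [hcoeff, ha0]
      change Matrix.trace ((ρ σ : GL (Fin 2) (PadicAlgCl p)) : Matrix (Fin 2) (Fin 2) (PadicAlgCl p)) = 0
      rw [htrσ, hc, Polynomial.coeff_map, heckePolynomial_coeff_one, map_neg, neg_neg, h0, map_zero]
    -- density: `C` is closed and contains `D`, hence is everything
    intro γ hγ
    have hγC : γ ∈ C := by
      have hcl : γ ∈ closure D := by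
        rw [hD.closure_eq]
        exact Set.mem_univ γ
      exact closure_minimal hDC hCclosed hcl
    rcases hγC with h | h
    · exact absurd h hγ
    · exact h
  exact isResiduallyAbsIrreducible_of_trace_eq_zero_off_subgroup hW (liftToGamma1 N 2 g) hg₁ p hp2 ι'
    hpN hap' ρ hρ hirr H hH htr w hw hI

/-- **Corollary C (supplier currency).**  Theorem B with the CM field packaged EXACTLY as the
existential `K`-conjunct of `BurungaleSkinnerTianWan2024.prop523proof_appB_exists_orientedCMNewform_PRE`
(`∃ K, IsImaginaryQuadratic K ∧ SatisfiesHeegnerHypothesis p K ∧ ∃ χK, χK|odd = (d_K/·) ∧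
∀ ℓ prime, ℓ ∤ N → χK ℓ · a_ℓ = a_ℓ`), so that a prover holding the PRE fact's output
`⟨N, _, g, hg, hpN, -, -, hKcl, hord, -, -⟩` closes the «F-irr» conjunct of `CalibratorSupplyNF`
by `isResiduallyAbsIrreducible_of_CM_clause hW g hg p hp2 hpN ι' (hord ι') ρ hρ hirr hKcl`.
[cite: BurungaleSkinnerTianWan2024, Prop. 5.23 and App. B] [cite: Hida2000, Thm. 3.26 (2), p. 152] -/
theorem isResiduallyAbsIrreducible_of_CM_clause (hW : Hida2000_thm326_ordinary_unitRoot)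
    {N : ℕ} [NeZero N] (g : CuspForm (CongruenceSubgroup.Gamma0 N) 2) (hg : IsNewform0 g)
    (p : ℕ) [Fact p.Prime] (hp2 : p ≠ 2) (hpN : ¬ p ∣ N) (ι' : PadicAlgCl p ≃+* ℂ)
    (hap : ‖ι'.symm (cuspCoeff g p)‖ = 1)
    (ρ : FramedGaloisRep ℚ (PadicAlgCl p) 2)
    (hρ : IsGaloisRepOfNewform1 (liftToGamma1 N 2 g)
      (ι'.symm.toRingHom.comp (algebraMap (coeffCharField (liftToGamma1 N 2 g)) ℂ))
      {ℓ : ℕ | ℓ ∣ N * p} ρ)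
    (hirr : ρ.toGaloisRep.IsIrreducible)
    (hKcl : ∃ (K : Type) (_ : Field K) (_ : NumberField K), IsImaginaryQuadratic K ∧
        SatisfiesHeegnerHypothesis p K ∧
        ∃ χK : DirichletCharacter ℂ (NumberField.discr K).natAbs,
          (∀ n : ℕ, Odd n → χK n = (jacobiSym (NumberField.discr K) n : ℂ)) ∧
          ∀ ℓ : ℕ, ℓ.Prime → ¬ ℓ ∣ N → χK ℓ * cuspCoeff g ℓ = cuspCoeff g ℓ) :
    ρ.IsResiduallyAbsIrreducible := by
  obtain ⟨K, _, _, hK, hpK, χK, hχK, hCM⟩ := hKcl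
  exact isResiduallyAbsIrreducible_of_CM hW g hg p hp2 hpN ι' hap ρ hρ hirr hK hpK χK hχK hCM

end Docking

/-! ## PART D — the turnkey: `ρ` constructed, `hirr` discharged (rev 1.1) -/

section Turnkey

open Literature.NumberTheory.EllipticCurves.GreenbergSelmer Literature.FieldTheory.AlgClosed

/-- **D.1 (attached AND irreducible, over `ℚ̄_p`, for the comparison `ι'` you hold).**  For a newform
`g ∈ S_k(Γ₀(N))`, `k ≥ 2`, a prime `p ∤ N` and ANY `ι' : ℚ̄_p ≃+* ℂ` with `‖ι'⁻¹(a_p(g))‖ = 1`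
there is `ρ : Γ_ℚ → GL₂(ℚ̄_p)` attached to the `Γ₁(N)`-lift of `g` through `ι'⁻¹|_{K₁}` away from
`N p` which is IRREDUCIBLE: `ρ := Δ.ρ ⊗ ℚ̄_p` for the integral ordinary datum `Δ` of `(g, p, ι'⁻¹|_{K_g})`
(`nonempty_ordinaryNewformDatum_of_thm61_of_thm326`), attached by
`OrdinaryNewformDatum.isGaloisRepOfNewform1_baseChange_padicAlgCl` (the two coefficient maps
`ι'⁻¹|_{K_g} ∘ (K₁ ⊆ K_g)` and `ι'⁻¹ ∘ (K₁ ⊆ ℂ)` agree definitionally), irreducible by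
`OrdinaryNewformDatum.isIrreducible_baseChange_padicAlgCl` (Ribet Thm. (2.3), PROVED in the tree;
`K = ℚ_p(ι K_g)` is finite over `ℚ_p`, `GreenbergSelmer.finiteDimensional_padicCoeffField`, since
`K_g` is a number field, `IsNewform0.finiteDimensional_coeffField_holds`).
[cite: DeligneSerreASENS1974, Thm. 6.1] [cite: Ribet1977Nebentypus, Thm. (2.3)]
[cite: Hida2000, Thm. 3.26 (1)–(2), pp. 151–152] -/
theorem exists_attached_isIrreducible
    (h61 : DeligneSerre1974.thm61_exists_adicGaloisRep) (h326 : Hida2000_thm326_ordinary)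
    {N : ℕ} [NeZero N] {k : ℤ} (g : CuspForm (CongruenceSubgroup.Gamma0 N) k) (hg : IsNewform0 g)
    (hk : 2 ≤ k) (p : ℕ) [Fact p.Prime] (hpN : ¬ p ∣ N) (ι' : PadicAlgCl p ≃+* ℂ)
    (hap : ‖ι'.symm (cuspCoeff g p)‖ = 1) :
    ∃ ρ : FramedGaloisRep ℚ (PadicAlgCl p) 2,
      IsGaloisRepOfNewform1 (liftToGamma1 N k g)
        (ι'.symm.toRingHom.comp (algebraMap (coeffCharField (liftToGamma1 N k g)) ℂ))
        {ℓ : ℕ | ℓ ∣ N * p} ρ ∧ ρ.toGaloisRep.IsIrreducible := by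
  classical
  -- the coefficient embedding `K_g → ℚ̄_p` cut out by `ι'`
  obtain ⟨ι, hι⟩ : ∃ ι : coeffField g →+* PadicAlgCl p,
      ι = ι'.symm.toRingHom.comp (algebraMap (coeffField g) ℂ) := ⟨_, rfl⟩
  have hιap : ‖ι ⟨(UpperHalfPlane.qExpansion 1 ⇑g).coeff p, coeff_mem_coeffField g p⟩‖ = 1 := by
    rw [hι]; exact hap
  obtain ⟨Δ⟩ := nonempty_ordinaryNewformDatum_of_thm61_of_thm326 h61 h326 g hg hk p hpN ι hιap
  haveI : FiniteDimensional ℚ (coeffField g) := IsNewform0.finiteDimensional_coeffField_holds hg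
  haveI : FiniteDimensional ℚ_[p] (padicCoeffField ι) :=
    GreenbergSelmer.finiteDimensional_padicCoeffField ι
  refine ⟨FramedRep.baseChange (padicCoeffIntegers.toPadicAlgCl ι) continuous_toPadicAlgCl Δ.ρ, ?_,
    Δ.isIrreducible_baseChange_padicAlgCl hg (by omega)⟩
  have hρ := Δ.isGaloisRepOfNewform1_baseChange_padicAlgCl hg (by omega : 1 ≤ k)
  have hj : ι.comp (IntermediateField.inclusion
        (coeffCharField_liftToGamma1_le (isNewform0_ne_zero hg))).toRingHom =
      ι'.symm.toRingHom.comp (algebraMap (coeffCharField (liftToGamma1 N k g)) ℂ) := by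
    subst hι
    rfl
  rw [hj] at hρ
  exact hρ

/-- **D.2 (the calibrator's representation, for the `ι'` you hold).**  From `hW` (GRANTED Hida Thm.
3.26 (2), the cell's standard printed fact), Deligne's theorem `h61` and the BSTW App. B output
(`g` a `p`-ordinary CM newform of weight `2`, level prime to `p`, `p ≠ 2`, with its `K`-clause):
there is `ρ` attached to `(g₁, ι'⁻¹)` away from `Np` which is irreducible AND residually absolutely
irreducible — conjuncts #3 and #4 of `CalibratorSupplyNF` for the given `ι'`, with NO `hirr`
hypothesis (D.1 + Corollary C).
[cite: BurungaleSkinnerTianWan2024, Prop. 5.23 and App. B] [cite: Hida2000, Thm. 3.26 (2), p. 152]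
[cite: Ribet1977Nebentypus, Thm. (2.3)] -/
theorem exists_calibratorRep_of_CM_clause (hW : Hida2000_thm326_ordinary_unitRoot)
    (h61 : DeligneSerre1974.thm61_exists_adicGaloisRep)
    {N : ℕ} [NeZero N] (g : CuspForm (CongruenceSubgroup.Gamma0 N) 2) (hg : IsNewform0 g)
    (p : ℕ) [Fact p.Prime] (hp2 : p ≠ 2) (hpN : ¬ p ∣ N) (ι' : PadicAlgCl p ≃+* ℂ)
    (hap : ‖ι'.symm (cuspCoeff g p)‖ = 1)
    (hKcl : ∃ (K : Type) (_ : Field K) (_ : NumberField K), IsImaginaryQuadratic K ∧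
        SatisfiesHeegnerHypothesis p K ∧
        ∃ χK : DirichletCharacter ℂ (NumberField.discr K).natAbs,
          (∀ n : ℕ, Odd n → χK n = (jacobiSym (NumberField.discr K) n : ℂ)) ∧
          ∀ ℓ : ℕ, ℓ.Prime → ¬ ℓ ∣ N → χK ℓ * cuspCoeff g ℓ = cuspCoeff g ℓ) :
    ∃ ρ : FramedGaloisRep ℚ (PadicAlgCl p) 2,
      IsGaloisRepOfNewform1 (liftToGamma1 N 2 g)
        (ι'.symm.toRingHom.comp (algebraMap (coeffCharField (liftToGamma1 N 2 g)) ℂ))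
        {ℓ : ℕ | ℓ ∣ N * p} ρ ∧
      ρ.IsResiduallyAbsIrreducible ∧ ρ.toGaloisRep.IsIrreducible := by
  obtain ⟨ρ, hρ, hirr⟩ := exists_attached_isIrreducible h61 (Hida2000_thm326_ordinary_of_unitRoot hW)
    g hg le_rfl p hpN ι' hap
  exact ⟨ρ, hρ, isResiduallyAbsIrreducible_of_CM_clause hW g hg p hp2 hpN ι' hap ρ hρ hirr hKcl, hirr⟩

/-- **D.3 (conjuncts #3, #4, #5 of `CalibratorSupplyNF`, token for token, with the comparison
`ι'` produced as well).**  From `hW`, `h61` and the PRE fact's output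
`⟨N, _, g, hg, hpN, -, -, hKcl, hord, -, -⟩` alone:
`∃ ι' ρ, IsGaloisRepOfNewform1 g₁ (ι'⁻¹ ∘ (K₁ ⊆ ℂ)) {ℓ ∣ Np} ρ ∧ ρ.IsResiduallyAbsIrreducible ∧
‖ι'⁻¹(a_p(g))‖ = 1` (a ring isomorphism `ℚ̄_p ≃ ℂ` exists:
`exists_padicAlgCl_ringEquiv_complex_apply_eq_of_finiteDimensional`).  The typer's gap #4 «F-irr»
is thereby CLOSED modulo exactly the two named printed facts `hW`, `h61`.
[cite: BurungaleSkinnerTianWan2024, Prop. 5.23 and App. B] [cite: Hida2000, Thm. 3.26 (2), p. 152]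
[cite: DeligneSerreASENS1974, Thm. 6.1] -/
theorem exists_compat_calibratorRep_of_CM_clause (hW : Hida2000_thm326_ordinary_unitRoot)
    (h61 : DeligneSerre1974.thm61_exists_adicGaloisRep)
    {N : ℕ} [NeZero N] (g : CuspForm (CongruenceSubgroup.Gamma0 N) 2) (hg : IsNewform0 g)
    (p : ℕ) [Fact p.Prime] (hp2 : p ≠ 2) (hpN : ¬ p ∣ N)
    (hord : ∀ ι' : PadicAlgCl p ≃+* ℂ, ‖ι'.symm (cuspCoeff g p)‖ = 1)
    (hKcl : ∃ (K : Type) (_ : Field K) (_ : NumberField K), IsImaginaryQuadratic K ∧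
        SatisfiesHeegnerHypothesis p K ∧
        ∃ χK : DirichletCharacter ℂ (NumberField.discr K).natAbs,
          (∀ n : ℕ, Odd n → χK n = (jacobiSym (NumberField.discr K) n : ℂ)) ∧
          ∀ ℓ : ℕ, ℓ.Prime → ¬ ℓ ∣ N → χK ℓ * cuspCoeff g ℓ = cuspCoeff g ℓ) :
    ∃ (ι' : PadicAlgCl p ≃+* ℂ) (ρ : FramedGaloisRep ℚ (PadicAlgCl p) 2),
      IsGaloisRepOfNewform1 (liftToGamma1 N 2 g)
        (ι'.symm.toRingHom.comp (algebraMap (coeffCharField (liftToGamma1 N 2 g)) ℂ))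
        {ℓ : ℕ | ℓ ∣ N * p} ρ ∧
      ρ.IsResiduallyAbsIrreducible ∧ ‖ι'.symm (cuspCoeff g p)‖ = 1 := by
  obtain ⟨ι', -⟩ := exists_padicAlgCl_ringEquiv_complex_apply_eq_of_finiteDimensional
    (algebraMap ℚ (PadicAlgCl p)) (algebraMap ℚ ℂ)
  obtain ⟨ρ, hρ, hres, -⟩ := exists_calibratorRep_of_CM_clause hW h61 g hg p hp2 hpN ι' (hord ι') hKcl
  exact ⟨ι', ρ, hρ, hres, hord ι'⟩

end Turnkey

/-! ## PART E — `CalibratorSupplyNF L p` ITSELF (all eight conjuncts), i.e. the statement of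
`bstw_door.stub_calibratorSupplyNF` (item 33169, S2a-NF) VERBATIM, from exactly THREE named printed facts:
`hW` (Hida 2000 Thm. 3.26 (2), GRANTED cell fact), `h61` (Deligne–Serre 1974 Thm. 6.1 / Deligne 1971,
named Literature fact) and `hPRE` (BSTW24 proof of Prop. 5.23 with App. B, typer fact p801618
`prop523proof_appB_exists_orientedCMNewform_PRE`).  Conjuncts: #1 `IsNewform0` (PRE) · #2 `p ∤ 2N` (PRE's
`p ∤ N` + `p ≥ 5` prime) · #3 #4 #5 (PART D) · #6 Heegner at `N` (PRE) · #7 analytic rank one (PRE's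
`HasAnalyticRankOneAt g`, definitionally the consumer's clause) · #8 (PRE's `TwistedLValueOneNeZero g χL`,
definitionally the consumer's 4-tuple after moving `LχL` out).  No curve appears; nothing about BSD. -/

section Supply

open Literature.NumberTheory.EllipticCurves.GreenbergSelmer Literature.FieldTheory.AlgClosed
open Literature.NumberTheory.EllipticCurves.BurungaleSkinnerTianWan2024
open Summit.BirchSwinnertonDyer.BirchSwinnertonDyer.Theorems

/-- **E (the supply turnkey) — `stub_calibratorSupplyNF` of `Cruxes/KatoValuationIneqNonsplitAtFive/Lines/bstw_door.lean`
token for token, from `hW`, `h61`, `hPRE`.**  At every admissible `(L, p)` — `p ≥ 5`, `L` imaginary quadratic,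
Heegner at `p`, `d_L < −4` odd — `CalibratorSupplyNF L p`.  (`d_L < −4` gives `d_L ≠ −4`; `d_L` odd gives
`d_L ≠ −8`; `p ≥ 5` gives `p ≠ 2`, whence `p ∤ 2N` from `p ∤ N`.)
[cite: BurungaleSkinnerTianWan2024, proof of Prop. 5.23 (TeX l.4587–4615) with App. B Lemma B.2 (l.6554–6583) and §7.2 l.6065]
[cite: Hida2000, Thm. 3.26 (2), p. 152] [cite: DeligneSerreASENS1974, Thm. 6.1] [cite: Ribet1977, Thm. (2.3)] -/
theorem calibratorSupplyNF_of_printedFacts (hW : Hida2000_thm326_ordinary_unitRoot)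
    (h61 : DeligneSerre1974.thm61_exists_adicGaloisRep)
    (hPRE : prop523proof_appB_exists_orientedCMNewform_PRE) :
    ∀ (p : ℕ) [Fact p.Prime], 5 ≤ p → ∀ (L : Type) [Field L] [NumberField L],
      IsImaginaryQuadratic L → SatisfiesHeegnerHypothesis p L → NumberField.discr L < -4 →
      Odd (NumberField.discr L) → ErratumRoadFiveBdvCalibrationSplitNF.CalibratorSupplyNF L p := by
  intro p _ hp5 L _ _ hL hHeeg hlt hodd
  have hp2 : p ≠ 2 := by omega
  have hd4 : NumberField.discr L ≠ -4 := by omega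
  have hd8 : NumberField.discr L ≠ -8 := by
    rintro h
    rw [h] at hodd
    exact absurd hodd (by decide)
  obtain ⟨N, _, g, hg, hpN, hHeegN, -, hKcl, hord, hrk1, χL, hχL, LχL, hdiff, hagree, hne⟩ :=
    hPRE p hp2 L hL hHeeg hd4 hd8
  obtain ⟨ι', ρ, hρ, hFirr, hap⟩ :=
    exists_compat_calibratorRep_of_CM_clause hW h61 g hg p hp2 hpN hord hKcl
  have hp2N : ¬ p ∣ 2 * N := by
    intro h
    have hp : p.Prime := Fact.out
    rcases hp.dvd_mul.mp h with h2 | hN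
    · exact hp2 ((Nat.prime_dvd_prime_iff_eq hp Nat.prime_two).mp h2)
    · exact hpN hN
  exact ⟨N, inferInstance, g, ι', ρ, hg, hp2N, hρ, hFirr, hap, hHeegN, hrk1, χL, LχL, hχL, hdiff,
    hagree, hne⟩

/-- **E′ (pointwise form)**: the same at one admissible `(L, p)`, hypotheses as the PRE fact wants them
(`p ≠ 2`, `d_L ∉ {−4, −8}`) — slightly more general than the stub's `p ≥ 5`, `d_L < −4` odd. -/
theorem calibratorSupplyNF_of_printedFacts' (hW : Hida2000_thm326_ordinary_unitRoot)
    (h61 : DeligneSerre1974.thm61_exists_adicGaloisRep)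
    (hPRE : prop523proof_appB_exists_orientedCMNewform_PRE)
    (p : ℕ) [Fact p.Prime] (hp2 : p ≠ 2) (L : Type) [Field L] [NumberField L]
    (hL : IsImaginaryQuadratic L) (hHeeg : SatisfiesHeegnerHypothesis p L)
    (hd4 : NumberField.discr L ≠ -4) (hd8 : NumberField.discr L ≠ -8) :
    ErratumRoadFiveBdvCalibrationSplitNF.CalibratorSupplyNF L p := by
  obtain ⟨N, _, g, hg, hpN, hHeegN, -, hKcl, hord, hrk1, χL, hχL, LχL, hdiff, hagree, hne⟩ :=
    hPRE p hp2 L hL hHeeg hd4 hd8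
  obtain ⟨ι', ρ, hρ, hFirr, hap⟩ :=
    exists_compat_calibratorRep_of_CM_clause hW h61 g hg p hp2 hpN hord hKcl
  have hp2N : ¬ p ∣ 2 * N := by
    intro h
    have hp : p.Prime := Fact.out
    rcases hp.dvd_mul.mp h with h2 | hN
    · exact hp2 ((Nat.prime_dvd_prime_iff_eq hp Nat.prime_two).mp h2)
    · exact hpN hN
  exact ⟨N, inferInstance, g, ι', ρ, hg, hp2N, hρ, hFirr, hap, hHeegN, hrk1, χL, LχL, hχL, hdiff,
    hagree, hne⟩

end Supply

end Summit.BirchSwinnertonDyer.BirchSwinnertonDyer.Cruxes.EulerHalfNotRamNoInertSetAtFive.CalibratorFirr
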